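import Summits.ValiantsHypothesis.ValiantsHypothesis.Theorems.DepthWindowULBTwo
import Summits.ValiantsHypothesis.ValiantsHypothesis.Theorems.DepthWindowTreeBiasGrowthOne
import Summits.ValiantsHypothesis.ValiantsHypothesis.Theorems.DepthWindowBoundedLettersLog

/-!
# Route `DepthWindow` — the tree-bias DICHOTOMY on the depth axis: slope `1` grows, slope `2` does not

Cone-free theorem (decomp-valiant lens 4, g16) supporting the crux item `HomImmHardTwoOne`
(stmt-ValiantsHypothesis-30635).  With `universalLowBiasAt_two` (g16, `DepthWindowULBTwo`) and
`treeBiasGrowthAt_one` / `not_universalLowBiasAt_one` (g14, `DepthWindowTreeBiasGrowthOne`) the two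
slope-indexed families of statements of `DepthWindowNodeBias` are now DECIDED AT EVERY SLOPE:

* `universalLowBiasAt_iff` — `UniversalLowBiasAt C ↔ 2 ≤ C`;
* `treeBiasGrowthAt_iff` — `TreeBiasGrowthAt a ↔ a ≤ 1`;
* `universalLowBias`, `not_treeBiasGrowth` — the unsloped statements: `ULB` holds, `TreeBiasGrowth` fails.

Reading for the A-cell: the tree-bias door `homImmHardAt_two_one_of_treeBiasAt` (slope `2u`, `u ≥ 1` the
unrolling constant) is closed for every `u`, while the slope at which words DO force growth (`a = 1`, BDS
golden-ratio words) is below every door of this shape — the lopsided relative-rank method with levelled word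
trees is a BARRIER on the depth axis exactly in the window `(1, 2)` of slopes it would need.

References: [LimayeSrinivasanTavenas2022] CCC 2022 Question 1, Thm. 5, Remark 25; [BhargavDuttaSaxena2024]
ACM ToCT 16(4):23 Thm. 1.4, Thm. 1.7.
-/

-- layout Summits/ValiantsHypothesis/ValiantsHypothesis forces the duplicated namespace component
set_option linter.dupNamespace false

namespace Summit.ValiantsHypothesis.ValiantsHypothesis.Theorems.DepthWindow.TreeBias

open Finset Literature.Computability.AlgebraicComplexity

/-- `ULB_C` is monotone in the slope `C` (pad the tree; enlarge the bias constant by one to cover the root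
constraint). [folklore] -/
theorem UniversalLowBiasAt.mono {C C' : ℕ} (hU : UniversalLowBiasAt C) (hle : C ≤ C') :
    UniversalLowBiasAt C' := by
  obtain ⟨B, c₁, hB⟩ := hU
  refine ⟨B + 1, c₁, fun d w h hw hsum => ?_⟩
  have hβ : ((B * h : ℕ) : ℤ) ≤ (((B + 1) * h : ℕ) : ℤ) := by push_cast; nlinarith
  have hs : |∑ j, w j| ≤ (((B + 1) * h : ℕ) : ℤ) := by
    push_cast; have : (0 : ℤ) ≤ (B : ℤ) * h := by positivity
    linarith
  exact ((hB d w h hw hsum).bias_mono hβ).depth_mono (by nlinarith) hs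

/-- **`ULB` holds** (some slope — indeed slope `2`). [cite: LimayeSrinivasanTavenas2022, Thm. 27, Question 1] -/
theorem universalLowBias : UniversalLowBias := ⟨2, universalLowBiasAt_two⟩

/-- **The `ULB` dichotomy**: `UniversalLowBiasAt C ↔ 2 ≤ C`. [cite: BhargavDuttaSaxena2024, Thm. 1.4, Thm. 1.7] -/
theorem universalLowBiasAt_iff {C : ℕ} : UniversalLowBiasAt C ↔ 2 ≤ C := by
  constructor
  · intro hU
    by_contra hC
    interval_cases C
    · exact not_universalLowBiasAt_zero hU
    · exact not_universalLowBiasAt_one hU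
  · exact fun hC => universalLowBiasAt_two.mono hC

/-- No tree-bias growth at any slope `a ≥ 2`. [cite: LimayeSrinivasanTavenas2022, Prop. 17] -/
theorem not_treeBiasGrowthAt_of_two_le {a : ℕ} (ha : 2 ≤ a) : ¬ TreeBiasGrowthAt a :=
  not_treeBiasGrowthAt_of_ULB universalLowBiasAt_two ha

/-- **The growth dichotomy**: `TreeBiasGrowthAt a ↔ a ≤ 1` — golden-ratio words force growth at slope `1`
(g14), the universal two-level builder forbids it from slope `2` on (g16).
[cite: BhargavDuttaSaxena2024, Thm. 1.4] [cite: LimayeSrinivasanTavenas2022, Question 1] -/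
theorem treeBiasGrowthAt_iff {a : ℕ} : TreeBiasGrowthAt a ↔ a ≤ 1 := by
  constructor
  · intro hG; by_contra ha
    exact not_treeBiasGrowthAt_of_two_le (by omega) hG
  · exact fun ha => treeBiasGrowthAt_anti ha treeBiasGrowthAt_one

/-- **The all-slopes growth statement `TreeBiasGrowth` of `DepthWindowTreeBiasBridge` is FALSE.**
[cite: LimayeSrinivasanTavenas2022, Prop. 17] -/
theorem not_treeBiasGrowth : ¬ TreeBiasGrowth := not_treeBiasGrowth_of_ULB universalLowBias

end Summit.ValiantsHypothesis.ValiantsHypothesis.Theorems.DepthWindow.TreeBias
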